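import Mathlib
import HarnessLib

/-!
# N2 (frames-only node, OPEN) — (F) column under (R-44)(c): **THE ONE-SIDED (FORWARD-ONLY) RUN COUNT WITH WINDOW LANDING** (cell-free arithmetic)

J23/(R-44)(c) (lead g12 2026-08-23T11:31:15Z, design owner p3-g17): the face route's tangential run may only move FORWARD (near sign `1`; Lemma B9),
so instead of aiming at the target CENTRE with a sign `σT = ±1` (`σTX := if F ≤ T then 1 else −1`, N1/T numbers) it aims at the target WINDOW
`[T − bw, T + bw]` from a start `F ≤ T + bw` (the contact is forward-bounded by the asymmetric room `hF⊥` of `PCells2V`, p5-g16's feasibility row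
`ρ⊥ + oh + W ≤ b⊥`): take **`fwdCount T F u bw := ⌈(T − bw − F)/u⌉⁺`** strides of length `u ≤ 2·bw`; then the landing `F + u·fwdCount` lies in the
window (`fwdCount_spec`), and no stride is taken when the start is already inside (`fwdCount_eq_zero`).  This is the arithmetic heart of hp-8 g43's
one-sided counts `σTX := 1`, `N3X := fwdCount …` (design note, lane 12:56:11Z); values only, no cells, no probability.
NON-VACUITY: `fwdCount 0 0 1 0 = 0`; hypotheses `0 < u`, `u ≤ 2·bw`, `F ≤ T + bw` are the stride/window/forward-contact rows of record.
builds on p205010 (kernel theorem, internal audit signed; external expert review pending) — nothing here uses p205010; NOTHING is claimed about the open node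
`SamePDropOfSkeletonFrm₁`.
Lane `prim-bschramm`, seat `prim-hp-8` (gen 42); helper file (`--supports stmt-CriticalPhenomena-4575 --as helper`).
* `Skelφ.fwdCount`, `fwdCount_eq_zero`, `le_mul_fwdCount`, `mul_fwdCount_lt`, **`fwdCount_spec`**.
[cite: KozmaNitzan2024, §4 Lemma 11 (p. 22), Lemma 12 (pp. 23–25)] [cite: MartineauTassion2017, §4.1]
-/

namespace Summit.CriticalPhenomena.PercolationContinuityZ3.Theorems.Transplant

namespace Skelφ

/-- **The forward stride count to the window's near edge**: `⌈(T − bw − F)/u⌉⁺` (`0` when `T − bw ≤ F`). [this work] -/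
def fwdCount (T F : ℤ) (u bw : ℕ) : ℕ := Int.toNat (-((F - T + bw) / (u : ℤ)))

/-- Already inside (or beyond the near edge of) the window: no stride. [folklore] -/
theorem fwdCount_eq_zero {T F : ℤ} {u bw : ℕ} (hu : 0 < u) (h : T - bw ≤ F) : fwdCount T F u bw = 0 := by
  unfold fwdCount
  have h0 : 0 ≤ (F - T + bw) / (u : ℤ) := Int.ediv_nonneg (by omega) (by exact_mod_cast hu.le)
  exact Int.toNat_of_nonpos (by omega)

/-- The strides reach the near edge: `T − bw ≤ F + u·fwdCount`. [folklore] -/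
theorem le_mul_fwdCount {T F : ℤ} {u bw : ℕ} (hu : 0 < u) : T - bw ≤ F + (u : ℤ) * fwdCount T F u bw := by
  unfold fwdCount
  have hu' : (0 : ℤ) < u := by exact_mod_cast hu
  set a : ℤ := F - T + bw with ha
  have hdiv : a % (u : ℤ) + a / (u : ℤ) * (u : ℤ) = a := Int.emod_add_ediv_mul a (u : ℤ)
  have hmod0 := Int.emod_nonneg a hu'.ne'
  have hmodu := Int.emod_lt_of_pos a hu'
  by_cases hq : 0 ≤ a / (u : ℤ)
  · rw [Int.toNat_of_nonpos (by omega)]; push_cast; nlinarith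
  · push Not at hq
    have : ((-(a / (u : ℤ))).toNat : ℤ) = -(a / (u : ℤ)) := Int.toNat_of_nonneg (by omega)
    rw [this]; nlinarith

/-- The strides do not overshoot by a full stride: `u·fwdCount < (T − bw − F) + u` when a stride is taken, hence the landing is `< T − bw + u`;
with `fwdCount = 0` the landing is `F`. Packaged: `F + u·fwdCount ≤ max F (T − bw + u − 1)`. [folklore] -/
theorem mul_fwdCount_lt {T F : ℤ} {u bw : ℕ} (hu : 0 < u) : F + (u : ℤ) * fwdCount T F u bw ≤ max F (T - bw + u - 1) := by
  unfold fwdCount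
  have hu' : (0 : ℤ) < u := by exact_mod_cast hu
  set a : ℤ := F - T + bw with ha
  have hdiv : a % (u : ℤ) + a / (u : ℤ) * (u : ℤ) = a := Int.emod_add_ediv_mul a (u : ℤ)
  have hmod0 := Int.emod_nonneg a hu'.ne'
  have hmodu := Int.emod_lt_of_pos a hu'
  by_cases hq : 0 ≤ a / (u : ℤ)
  · rw [Int.toNat_of_nonpos (by omega)]; push_cast; simp
  · push Not at hq
    have : ((-(a / (u : ℤ))).toNat : ℤ) = -(a / (u : ℤ)) := Int.toNat_of_nonneg (by omega)
    rw [this]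
    refine le_trans ?_ (le_max_right _ _)
    nlinarith

/-- **WINDOW LANDING**: from a forward-bounded start `F ≤ T + bw` with strides `0 < u ≤ 2·bw`, the landing `F + u·fwdCount` lies in
`[T − bw, T + bw]`. [this work] -/
theorem fwdCount_spec {T F : ℤ} {u bw : ℕ} (hu : 0 < u) (huw : (u : ℤ) ≤ 2 * bw) (hF : F ≤ T + bw) :
    T - bw ≤ F + (u : ℤ) * fwdCount T F u bw ∧ F + (u : ℤ) * fwdCount T F u bw ≤ T + bw := by
  refine ⟨le_mul_fwdCount hu, (mul_fwdCount_lt (T := T) (F := F) (bw := bw) hu).trans (max_le hF (by omega))⟩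

end Skelφ

end Summit.CriticalPhenomena.PercolationContinuityZ3.Theorems.Transplant
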